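import Summits.NavierStokesRegularity.FluidComputer.PalasekTowerGermHostRateAmplifier
import Literature.Analysis.FluidPDE.ElgindiBlowup
import Mathlib.MeasureTheory.Measure.Lebesgue.VolumeOfBalls

/-!
# The germ host, XXVIII: amplifiers FROM A VECTOR POTENTIAL — `W = curl A` with `A ∈ C_c^∞`, `‖DA‖ ≤ L`

Cell `ns-blowup`, seat `ns-blowup-ecbridge-3` (g5); GROUP C «BRIDGE SUPPORT» of the route
`PalasekTowerBreakdown` (crux `EpisodeBaseG`, item stmt-NavierStokesRegularity-19179, R2; line `slot` v5). Sequel of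
`PalasekTowerGermHostRateAmplifier.lean` (the amplifier rule with numeric carrier scale and numeric budget) —
the form a typist needs the hour a mechanism card's KEEP names an amplifier (holder's read of
«orthogonal-seed-contact-strain», 19179 evidence #54: «level-0 carrier := the strict-tiny flat blob via the
COMPANION RULE; W := P ∪ S» — a pair of fat dipoles and a seed, to be typed with compactly supported VELOCITY,
i.e. as the curl of a compactly supported potential). LABEL: E–C typing (KERNEL, proofs only). WHAT THIS IS NOT:
not Navier–Stokes evidence — level-`0` bookkeeping of PRESCRIBED composite profiles at one instant; nothing about
any flow after `τ₀`, `FirstEpisodeD`, `RungG 1` or blow-up.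

## What

For a vector potential `A ∈ C^∞(ℝ³; ℝ³)` with `tsupport A ⊆ B̄(0, R)` (`R ≥ 0`) and `‖DA(x)‖ ≤ L` everywhere,
the amplifier `W = curl A` is smooth, divergence free, supported in `B̄(0, R)`, has speed `≤ 4L`
(`Literature…norm_curl_le_four_mul`) and energy `∫‖W‖² ≤ (4L)² · (4π/3) R³` (§1). Hence (§2):

* `LevelZeroData.add_translate_curl` — ANY strict-slot carrier (anchor values `≥ m` on its argmax) plus
  `curl A (· − c)` at distance `1/N₀ ≤ d`, `ρ₁ + d + R < ‖c‖`, with `4L < Y₀` and the CLOSED-FORM budget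
  `(3/(2πd⁴)) Y₀ (4L)² (4π/3) R³ < m`, is a strict-slot filler of radius `‖c‖ + R`;
* **`levelZeroData_strictTinyProfile_add_curl_of_le`** — the numeric carrier `strictTinyProfile a`,
  `0 < a ≤ 11/648`, `7 + d + R < ‖c‖`, `m = Y₀³/200000`: `LevelZeroData (strictTinyProfile a + curl A (· − c)) (‖c‖ + R)`
  from FOUR numbers `(R, L, d, ‖c‖)` and two local facts about `A` (support, Jacobian bound) — host preparation
  and the crux reduction for that design follow (`hostPreparationD_curl_of_le`, `episodeBaseG_of_firstEpisodeD_curl_of_le`).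

References: S. Palasek, arXiv:2605.13827 §3.3 [cite: Palasek2026ElementaryModel, §3.3]; A. J. Majda, A. L. Bertozzi,
*Vorticity and Incompressible Flow* (CUP 2002), §1.1 (1.11), §2.4.1 [cite: MajdaBertozziCUP2002, §1.1 (1.11)].
-/

noncomputable section

namespace Summit.NavierStokesRegularity.FluidComputer.PalasekTowerClayBridge.Germ

open Set Function Filter Topology InnerProductSpace Metric MeasureTheory Real
open scoped Topology ContDiff RealInnerProductSpace

open Literature.Analysis.FluidPDE

/-! ## §1 The amplifier `W = curl A` of a compactly supported potential -/

section Potential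

variable {A : EuclideanSpace ℝ (Fin 3) → EuclideanSpace ℝ (Fin 3)} {R L : ℝ}

/-- `curl A` is smooth for smooth `A`. [folklore] -/
theorem contDiff_curl_top (hA : ContDiff ℝ ∞ A) : ContDiff ℝ ∞ (curl A) := by
  have h : ContDiff ℝ ((⊤ : ℕ∞) + 1 : ℕ∞) A := by simpa using hA
  exact contDiff_curl h

/-- `curl A` is divergence free (`div curl = 0`). [cite: MajdaBertozziCUP2002, §1.1 (1.11)] -/
theorem isDivFree_curl (hA : ContDiff ℝ ∞ A) : VectorCalculus.IsDivFree (curl A) :=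
  fun x => divergence_curl_eq_zero_holds _ (hA.of_le (by norm_cast)) x

/-- `tsupport (curl A) ⊆ tsupport A ⊆ B̄(0, R)`. [folklore] -/
theorem tsupport_curl_subset (hAsupp : tsupport A ⊆ closedBall 0 R) :
    tsupport (curl A) ⊆ closedBall (0 : EuclideanSpace ℝ (Fin 3)) R := by
  refine closure_minimal (fun x hx => ?_) isClosed_closedBall
  by_contra h
  exact hx (curl_eq_zero_of_notMem_tsupport fun h' => h (hAsupp h'))

/-- **Speed bound**: `‖curl A (x)‖ ≤ 4L` when `‖DA‖ ≤ L` everywhere. [cite: MajdaBertozziCUP2002, §1.1 (1.11)] -/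
theorem norm_curl_le_of_fderiv_le (hL : ∀ x, ‖fderiv ℝ A x‖ ≤ L) (x : EuclideanSpace ℝ (Fin 3)) :
    ‖curl A x‖ ≤ 4 * L :=
  (norm_curl_le_four_mul A x).trans (by linarith [hL x])

/-- **Energy bound**: `∫‖curl A‖² ≤ (4L)² · (4π/3) R³` (speed `≤ 4L` on the support ball `B̄(0, R)`, `R ≥ 0`,
zero outside). [folklore] -/
theorem integral_norm_curl_sq_le (hAsupp : tsupport A ⊆ closedBall 0 R) (hR : 0 ≤ R)
    (hL : ∀ x, ‖fderiv ℝ A x‖ ≤ L) :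
    ∫ x, ‖curl A x‖ ^ 2 ≤ (4 * L) ^ 2 * (R ^ 3 * (π * 4 / 3)) := by
  have hsupp := tsupport_curl_subset hAsupp
  have hpt : ∀ x, ‖curl A x‖ ^ 2 ≤
      (closedBall (0 : EuclideanSpace ℝ (Fin 3)) R).indicator (fun _ => (4 * L) ^ 2) x := by
    intro x
    by_cases hx : x ∈ closedBall (0 : EuclideanSpace ℝ (Fin 3)) R
    · rw [indicator_of_mem hx]
      exact pow_le_pow_left₀ (norm_nonneg _) (norm_curl_le_of_fderiv_le hL x) 2
    · rw [indicator_of_notMem hx, image_eq_zero_of_notMem_tsupport fun h => hx (hsupp h), norm_zero]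
      simp
  have hint : Integrable ((closedBall (0 : EuclideanSpace ℝ (Fin 3)) R).indicator fun _ => (4 * L) ^ 2) :=
    (integrable_indicator_iff measurableSet_closedBall).2
      (integrableOn_const (measure_closedBall_lt_top.ne))
  calc ∫ x, ‖curl A x‖ ^ 2 ≤ ∫ x, (closedBall (0 : EuclideanSpace ℝ (Fin 3)) R).indicator (fun _ => (4 * L) ^ 2) x :=
        integral_mono_of_nonneg (Eventually.of_forall fun x => by positivity) hint (Eventually.of_forall hpt)
    _ = (4 * L) ^ 2 * (R ^ 3 * (π * 4 / 3)) := by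
        rw [integral_indicator_const _ measurableSet_closedBall, measureReal_def,
          EuclideanSpace.volume_closedBall_fin_three, ENNReal.toReal_mul, ← ENNReal.ofReal_pow hR,
          ENNReal.toReal_ofReal (by positivity), ENNReal.toReal_ofReal (by positivity), smul_eq_mul]
        ring

end Potential

/-! ## §2 The amplifier rule for `W = curl A` -/

section Rule

variable {U₁ A : EuclideanSpace ℝ (Fin 3) → EuclideanSpace ℝ (Fin 3)} {ρ₁ R L d : ℝ}
  {c : EuclideanSpace ℝ (Fin 3)}

/-- The closed-form budget dominates the true one: `(3/(2πd⁴)) Y₀ ∫‖curl A‖² ≤ (3/(2πd⁴)) Y₀ (4L)² (4π/3) R³`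
(`d > 0`). [folklore] -/
theorem budget_curl_le (hAsupp : tsupport A ⊆ closedBall 0 R) (hR : 0 ≤ R)
    (hL : ∀ x, ‖fderiv ℝ A x‖ ≤ L) (hd : 0 < d) :
    3 / (2 * π * d ^ 4) * TowerRates.wide.Y 0 * ∫ x, ‖curl A x‖ ^ 2 ≤
      3 / (2 * π * d ^ 4) * TowerRates.wide.Y 0 * ((4 * L) ^ 2 * (R ^ 3 * (π * 4 / 3))) := by
  have hY := Host.wide_Y_zero_pos
  exact mul_le_mul_of_nonneg_left (integral_norm_curl_sq_le hAsupp hR hL) (by positivity)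

/-- **STRICT SLOT, amplifier from a potential**: a strict carrier with anchor values `≥ m` on its argmax plus
`curl A (· − c)` — `A ∈ C_c^∞`, `tsupport A ⊆ B̄(0, R)`, `R ≥ 0`, `‖DA‖ ≤ L`, `4L < Y₀` — at distance
`1/N₀ ≤ d`, `ρ₁ + d + R < ‖c‖`, under the CLOSED-FORM budget `(3/(2πd⁴)) Y₀ (4L)² (4π/3) R³ < m`, is a
strict-slot filler of radius `‖c‖ + R`. [cite: Palasek2026ElementaryModel, §3.3] -/
theorem LevelZeroData.add_translate_curl (h₁ : LevelZeroData U₁ ρ₁) {m : ℝ}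
    (hm : ∀ x, ‖U₁ x‖ = TowerRates.wide.Y 0 → m ≤ ⟪U₁ x, accel 1 U₁ x⟫)
    (hA : ContDiff ℝ ∞ A) (hAsupp : tsupport A ⊆ closedBall 0 R) (hR : 0 ≤ R)
    (hL : ∀ x, ‖fderiv ℝ A x‖ ≤ L) (hLY : 4 * L < TowerRates.wide.Y 0) (hdN : 1 / TowerRates.wide.N 0 ≤ d)
    (hc : ρ₁ + d + R < ‖c‖)
    (hbudget : 3 / (2 * π * d ^ 4) * TowerRates.wide.Y 0 * ((4 * L) ^ 2 * (R ^ 3 * (π * 4 / 3))) < m) :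
    LevelZeroData (U₁ + fun x => curl A (x - c)) (‖c‖ + R) := by
  have hd : 0 < d := lt_of_lt_of_le (by rw [Host.wide_N_zero]; norm_num) hdN
  exact h₁.add_translate (contDiff_curl_top hA) (isDivFree_curl hA) (tsupport_curl_subset hAsupp)
    (fun x => lt_of_le_of_lt (norm_curl_le_of_fderiv_le hL x) hLY) hR hdN hc hm
    ((budget_curl_le hAsupp hR hL hd).trans_lt hbudget)

variable {a : ℝ}

/-- **THE NUMERIC CARRIER WITH AN AMPLIFIER FROM A POTENTIAL**: for `0 < a ≤ 11/648`, `A ∈ C_c^∞` with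
`tsupport A ⊆ B̄(0, R)` (`R ≥ 0`), `‖DA‖ ≤ L`, `4L < Y₀`, `1/N₀ ≤ d`, `7 + d + R < ‖c‖` and
`(3/(2πd⁴)) Y₀ (4L)² (4π/3) R³ < Y₀³/200000`:
`LevelZeroData (strictTinyProfile a + curl A (· − c)) (‖c‖ + R)` — four numbers and two local facts about `A`.
[cite: Palasek2026ElementaryModel, §3.3] -/
theorem levelZeroData_strictTinyProfile_add_curl_of_le (ha : 0 < a) (h : a ≤ 11 / 648)
    (hA : ContDiff ℝ ∞ A) (hAsupp : tsupport A ⊆ closedBall 0 R) (hR : 0 ≤ R)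
    (hL : ∀ x, ‖fderiv ℝ A x‖ ≤ L) (hLY : 4 * L < TowerRates.wide.Y 0) (hdN : 1 / TowerRates.wide.N 0 ≤ d)
    (hc : 7 + d + R < ‖c‖)
    (hbudget : 3 / (2 * π * d ^ 4) * TowerRates.wide.Y 0 * ((4 * L) ^ 2 * (R ^ 3 * (π * 4 / 3))) <
      TowerRates.wide.Y 0 ^ 3 / 200000) :
    LevelZeroData (strictTinyProfile a + fun x => curl A (x - c)) (‖c‖ + R) :=
  (levelZeroData_strictTinyProfile_of_le ha h).add_translate_curl
    (fun x hx => anchor_strictTinyProfile_ge ha (h.trans (by norm_num)) x hx) hA hAsupp hR hL hLY hdN hc hbudget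

/-- **Host preparation for the potential-amplifier designs**, every push `c₄ ∈ (0, 1]`.
[cite: Palasek2026ElementaryModel, §3.3] -/
theorem hostPreparationD_curl_of_le (ha : 0 < a) (h : a ≤ 11 / 648)
    (hA : ContDiff ℝ ∞ A) (hAsupp : tsupport A ⊆ closedBall 0 R) (hR : 0 ≤ R)
    (hL : ∀ x, ‖fderiv ℝ A x‖ ≤ L) (hLY : 4 * L < TowerRates.wide.Y 0) (hdN : 1 / TowerRates.wide.N 0 ≤ d)
    (hc : 7 + d + R < ‖c‖)
    (hbudget : 3 / (2 * π * d ^ 4) * TowerRates.wide.Y 0 * ((4 * L) ^ 2 * (R ^ 3 * (π * 4 / 3))) <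
      TowerRates.wide.Y 0 ^ 3 / 200000) {c₄ : ℝ} (hc₄ : 0 < c₄) (hc₄' : c₄ ≤ 1) :
    HostPreparationD (HostClass.exact
      ((levelZeroData_strictTinyProfile_add_curl_of_le ha h hA hAsupp hR hL hLY hdN hc hbudget).schedule
        c₄ hc₄ hc₄')) :=
  (levelZeroData_strictTinyProfile_add_curl_of_le ha h hA hAsupp hR hL hLY hdN hc hbudget).hostPreparationD_exact
    hc₄ hc₄'

/-- **… and the crux for such a design is its episode.** [cite: Palasek2026ElementaryModel, §4] -/
theorem episodeBaseG_of_firstEpisodeD_curl_of_le (ha : 0 < a) (h : a ≤ 11 / 648)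
    (hA : ContDiff ℝ ∞ A) (hAsupp : tsupport A ⊆ closedBall 0 R) (hR : 0 ≤ R)
    (hL : ∀ x, ‖fderiv ℝ A x‖ ≤ L) (hLY : 4 * L < TowerRates.wide.Y 0) (hdN : 1 / TowerRates.wide.N 0 ≤ d)
    (hc : 7 + d + R < ‖c‖)
    (hbudget : 3 / (2 * π * d ^ 4) * TowerRates.wide.Y 0 * ((4 * L) ^ 2 * (R ^ 3 * (π * 4 / 3))) <
      TowerRates.wide.Y 0 ^ 3 / 200000) {c₄ : ℝ} (hc₄ : 0 < c₄) (hc₄' : c₄ ≤ 1)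
    (hF : FirstEpisodeD (HostClass.exact
      ((levelZeroData_strictTinyProfile_add_curl_of_le ha h hA hAsupp hR hL hLY hdN hc hbudget).schedule
        c₄ hc₄ hc₄'))) :
    EpisodeBaseG :=
  (levelZeroData_strictTinyProfile_add_curl_of_le ha h hA hAsupp hR hL hLY hdN hc hbudget).episodeBaseG_of_firstEpisodeD
    hc₄ hc₄' hF

end Rule

end Summit.NavierStokesRegularity.FluidComputer.PalasekTowerClayBridge.Germ

end
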